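import Mathlib
import Literature.AlgebraicGeometry.Resolution.QuadraticTransforms
import Literature.AlgebraicGeometry.Resolution.BlowupSequencesExtensions
import Literature.AlgebraicGeometry.Resolution.DifferentialOperators
import Literature.AlgebraicGeometry.Resolution.MarkedIdealsArithmetic
import Literature.AlgebraicGeometry.Resolution.RegularLocalOrder
import Literature.AlgebraicGeometry.Resolution.SmoothOfRegularFibre
import Literature.AlgebraicGeometry.Resolution.HasseSystemRegularParameters
import Summits.ResolutionOfSingularities.ResolutionOfSingularities.Theorems.ForcedTowerClasses
import HarnessLib

/-!
# AbsoluteRiderHasse — decomp-res node «AbsoluteRider» (lens-4 g20, critic row 132)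

Content VERBATIM from the decomp-res lens-4 g20 file `HOME/decomp-res-lens-4/g20/AbsoluteRider.lean` (sha256
d859489ca280dd37, 4114 l; HOME = run/shared/lean/pub/
decomp-res), of which l. 178–3705 are the g19 RiderCut body ALREADY in the tree (`Theorems/HugValuationCut*`,
`MarkingBudget*`, `WeightDescent*`, `FactorContact*`,
`CouplingCut*`, `RiderCutClasses` / `RiderCutKernels` / `MaxContactCutRiderCut`) and are NOT landed a second time;
the NEW content §38–§42 (l. 3707–4113) lands as
three files: `AbsoluteRider` (§38–§40, in the Theses cone), `AbsoluteRiderHasse` (§41, cone-free kernel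
instance), `AbsoluteRiderLucas` (§42, arithmetic).
Critic: CRITIC-LEDGER row 132 (CLEARED 2026-08-30T18:49:46Z, DECIDED-MOD-PORT +1: the impure principal column
(L,P,¬pure) of 32260 over EVERY ground field is
EMPTY modulo the costume port `AbsRiderPort` (+ `CouplingPort` + lower weights) · MAP +1: §41/§42 kernels).
Landed by decomp-res writer g7.

Tree file 2/3 of the node, OUTSIDE the Theses cone: §41 the 𝔽_p-ABSOLUTE Hasse–Schmidt system along ANY
regular system of parameters of ANY regular local ring
essentially of finite type over `ZMod p` — `perfectField_zmod`, `exists_absHasseSystem` (the tree's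
`exists_hasseSystem_of_span_eq_maximalIdeal` at the PERFECT
base `ZMod p` via `formallySmooth_of_isRegularLocalRing_of_perfectField`), `absHasseSystem_apply_mem_pow_sub` (the
riding inequality), `nonempty_algebra_zmod`,
`essFiniteType_zmod_of_tower`, `exists_absHasseSystem_of_tower`.  Critic h4/h5: this covers every ground field
FINITELY GENERATED over 𝔽_p (all
`𝔽_p(t₁,…,t_m)` and their finite extensions — imperfect); an ARBITRARY ground field rests on Abad 2019 Thm
4.11 (the port `AbsRiderPort`, file `AbsoluteRider`).
PROVED, 0 sorry; Literature-grade (the critic suggests a later move next to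
`Literature/…/HasseSystemRegularParameters.lean` by a typer).  Supports 32260.

[WRITER NOTE (decomp-res writer g7): as for every lens-4 node since g6, the content lives in the ONE namespace
`…Theorems.HugValuationCut` (the lens wrote
`…Theorems.AbsoluteRider`; only the namespace line differs) so that `RiderPort`, `CouplingPort`, `HugChain.…`
resolve against the landed units verbatim; global
`set_option` lines dropped; critic hygiene h2 applied in docstrings only («Cor 4.5» ↦ «Rem 4.5», arXiv
numbering of Abad 2019).  No new route aside: the node
decides a column, it does not re-locate the residual (host 32260 / root 30253 / up-links BY NAME in `AbsoluteRider`).]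

(Sources: Abad2019 (doi:10.1016/j.jalgebra.2018.12.021 = arXiv:1801.08458) Thm 4.11, Prop 4.4, Rem 4.5, Lemma 6.2,
Prop 6.3; CossartPiltant2019 Prop 2.50(3); CossartJannsenSaito2020 Key Thm 6.40; Giraud1975; EGA IV₄ 16.11.2; Stacks 00TV.)
-/

noncomputable section

open CategoryTheory AlgebraicGeometry IsLocalRing
open Literature.AlgebraicGeometry.Resolution
open Summit.ResolutionOfSingularities.ResolutionOfSingularities.Theorems
open ForcedTowerClasses

namespace Summit.ResolutionOfSingularities.ResolutionOfSingularities.Theorems.HugValuationCut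

/-! ## §41 (g20 · NEW · KERNEL, hypothesis-free TREE INSTANCE) The 𝔽_p-ABSOLUTE Hasse–Schmidt system along
ANY regular system of
parameters of ANY regular local ring essentially of finite type over `𝔽_p` — in particular of `𝒪_{X_j,x_j}`
for a tower over ANY ground
field finitely generated over its prime field (every IMPERFECT field `𝔽_p(t₁,…,t_m)` and its finite
extensions: `essFiniteType_zmod_of_tower`).
This is (R3ᵃᵇˢ) OUTRIGHT for those fields: the tree's `exists_hasseSystem_of_span_eq_maximalIdeal` at the
PERFECT base `𝔽_p = ZMod p`
(`formallySmooth_of_isRegularLocalRing_of_perfectField (ZMod p)`), with NO perfectness or separability hypothesis on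
`k` or `κ(x_j)`. -/

/-- `𝔽_p` is perfect (Mathlib instance; recorded as the pivot of §41). [folklore] -/
theorem perfectField_zmod (p : ℕ) [Fact p.Prime] : PerfectField (ZMod p) := inferInstance

/-- **KERNEL (PROVED, hypothesis-free tree instance) — THE ABSOLUTE HASSE SYSTEM.**  `R` ANY regular local ring,
essentially of finite type
over `𝔽_p` (`Algebra.EssFiniteType (ZMod p) R`; e.g. `𝒪_{X,x}` for `X` of finite type over a field `k`
finitely generated over `𝔽_p`, PERFECT OR
NOT, `x` ANY point, `κ(x)/k` separable OR NOT), `u : ι → R` ANY regular system of parameters (`(u) = 𝔪`,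
`|ι| = emb dim R`), `n` any truncation
level: there are `𝔽_p`-linear `Δ_q : R → R` (`q ∈ ℕ^ι`) with `Δ_0 = id`, the higher Leibniz rule (`|q|
≤ n`), the EXACT divided-power values
`Δ_q(u^β) = ∏ C(β_i,q_i) · u^{β−q}` (`|q| ≤ n`) and `Δ_q ∈ Diff^{≤d}_{R/𝔽_p}` (`|q| ≤ d ≤
n`).  Proof: `𝔽_p` is perfect, so `R` is formally
smooth over `𝔽_p` (tree `formallySmooth_of_isRegularLocalRing_of_perfectField`, Stacks 00TV) and the tree's EGA
IV₄ 16.11.2 assembly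
`exists_hasseSystem_of_span_eq_maximalIdeal` applies at the base `ZMod p`.  This is law (R3ᵃᵇˢ)'s operator
supply over every ground field
essentially of finite type over `𝔽_p`; the `k`-RELATIVE supply (g19's (R3)) needed `k` perfect. (Sources: EGAIV4,
Thm. 16.11.2; StacksProject, Tag 00TV.) -/
theorem exists_absHasseSystem {p : ℕ} [Fact p.Prime] {R : Type} [CommRing R] [IsRegularLocalRing R]
    [Algebra (ZMod p) R] [Algebra.EssFiniteType (ZMod p) R] {ι : Type} [Fintype ι] [DecidableEq ι]
    (u : ι → R) (hu : Ideal.span (Set.range u) = maximalIdeal R)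
    (hcard : Fintype.card ι = (maximalIdeal R).spanFinrank) (n : ℕ) :
    ∃ Δ : (ι →₀ ℕ) → (R →ₗ[ZMod p] R),
      (∀ b, Δ 0 b = b) ∧
      (∀ q : ι →₀ ℕ, q.degree ≤ n →
        ∀ f g : R, Δ q (f * g) = ∑ c ∈ Finset.HasAntidiagonal.antidiagonal q, Δ c.1 f * Δ c.2 g) ∧
      (∀ q β : ι →₀ ℕ, q.degree ≤ n →
        Δ q (∏ i, u i ^ β i) = ((∏ i ∈ q.support, (β i).choose (q i) : ℕ) : R) * ∏ i, u i ^ (β - q) i) ∧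
      (∀ (d : ℕ) (q : ι →₀ ℕ), q.degree ≤ d → d ≤ n → IsDiffOpLE (ZMod p) d (Δ q)) := by
  haveI : Algebra.FormallySmooth (ZMod p) R :=
    formallySmooth_of_isRegularLocalRing_of_perfectField (ZMod p) R
  exact exists_hasseSystem_of_span_eq_maximalIdeal u hu hcard n

/-- **the members of the absolute system lower every `I`-adic order by at most `|q|`** (`f ∈ I^m ⇒ Δ_q f ∈
I^{m−|q|}`): the riding
inequality `ord ≥ m − |q|` of (R1c)/(R3ᵃᵇˢ), hypothesis-free. (Sources: EGAIV4, Prop. 16.8.8.) -/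
theorem absHasseSystem_apply_mem_pow_sub {p : ℕ} {R : Type} [CommRing R] [Algebra (ZMod p) R] {ι : Type}
    {Δ : (ι →₀ ℕ) → (R →ₗ[ZMod p] R)} {n : ℕ}
    (hΔ : ∀ (d : ℕ) (q : ι →₀ ℕ), q.degree ≤ d → d ≤ n → IsDiffOpLE (ZMod p) d (Δ q))
    {q : ι →₀ ℕ} (hq : q.degree ≤ n) (I : Ideal R) {m : ℕ} {f : R} (hf : f ∈ I ^ m) :
    Δ q f ∈ I ^ (m - q.degree) :=
  (hΔ q.degree q le_rfl hq).apply_mem_pow_sub I m hf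

/-- the characteristic-`p` structure is intrinsic: a ring of characteristic `p` is a `ZMod p`-algebra (Mathlib
`ZMod.algebra`), so
`exists_absHasseSystem` speaks about `R` alone. [folklore] -/
theorem nonempty_algebra_zmod {p : ℕ} (R : Type) [CommRing R] [CharP R p] : Nonempty (Algebra (ZMod p) R) :=
  ⟨ZMod.algebra R p⟩

/-- **fields finitely generated over the prime field are covered**: if `k = Frac B` with `B` of finite type over `𝔽_p` (e.g.
`k = 𝔽_p(t₁,…,t_m)`, IMPERFECT for `m ≥ 1`, or any finite extension of it) and `R` is essentially of finite
type over `k` (e.g. a local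
ring `𝒪_{X,x}` of a `k`-scheme of finite type), then `R` is essentially of finite type over `𝔽_p`, so
`exists_absHasseSystem` applies to
`R` — with no perfectness anywhere. [folklore] -/
theorem essFiniteType_zmod_of_tower {p : ℕ} {B K R : Type} [CommRing B] [Field K] [CommRing R]
    [Algebra (ZMod p) B] [Algebra.FiniteType (ZMod p) B] [Algebra B K] [IsFractionRing B K]
    [Algebra (ZMod p) K] [IsScalarTower (ZMod p) B K] [Algebra K R] [Algebra.EssFiniteType K R]
    [Algebra (ZMod p) R] [IsScalarTower (ZMod p) K R] : Algebra.EssFiniteType (ZMod p) R := by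
  haveI : Algebra.EssFiniteType B K := Algebra.EssFiniteType.of_isLocalization K (nonZeroDivisors B)
  haveI : Algebra.EssFiniteType (ZMod p) K := Algebra.EssFiniteType.comp (ZMod p) B K
  exact Algebra.EssFiniteType.comp (ZMod p) K R

/-- **(R3ᵃᵇˢ) OUTRIGHT for such fields, packaged at a local ring of a tower**: for `R` regular local,
essentially of finite type over a
field `K = Frac B`, `B` of finite type over `𝔽_p`, and ANY r.s.p. `u`, the absolute Hasse system exists (every
truncation level). [folklore] -/
theorem exists_absHasseSystem_of_tower {p : ℕ} [Fact p.Prime] {B K R : Type} [CommRing B] [Field K] [CommRing R]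
    [IsRegularLocalRing R] [Algebra (ZMod p) B] [Algebra.FiniteType (ZMod p) B] [Algebra B K] [IsFractionRing B K]
    [Algebra (ZMod p) K] [IsScalarTower (ZMod p) B K] [Algebra K R] [Algebra.EssFiniteType K R]
    [Algebra (ZMod p) R] [IsScalarTower (ZMod p) K R] {ι : Type} [Fintype ι] [DecidableEq ι]
    (u : ι → R) (hu : Ideal.span (Set.range u) = maximalIdeal R)
    (hcard : Fintype.card ι = (maximalIdeal R).spanFinrank) (n : ℕ) :
    ∃ Δ : (ι →₀ ℕ) → (R →ₗ[ZMod p] R),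
      (∀ b, Δ 0 b = b) ∧
      (∀ q : ι →₀ ℕ, q.degree ≤ n →
        ∀ f g : R, Δ q (f * g) = ∑ c ∈ Finset.HasAntidiagonal.antidiagonal q, Δ c.1 f * Δ c.2 g) ∧
      (∀ q β : ι →₀ ℕ, q.degree ≤ n →
        Δ q (∏ i, u i ^ β i) = ((∏ i ∈ q.support, (β i).choose (q i) : ℕ) : R) * ∏ i, u i ^ (β - q) i) ∧
      (∀ (d : ℕ) (q : ι →₀ ℕ), q.degree ≤ d → d ≤ n → IsDiffOpLE (ZMod p) d (Δ q)) := by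
  haveI : Algebra.EssFiniteType (ZMod p) R := essFiniteType_zmod_of_tower (B := B) (K := K)
  exact exists_absHasseSystem u hu hcard n

end Summit.ResolutionOfSingularities.ResolutionOfSingularities.Theorems.HugValuationCut
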